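import Summits.QuantumFields.YangMills.Theorems.BalabanLadderNTWeakPackageThreePoint
import Summits.QuantumFields.YangMills.Theorems.LangevinControlUVOSLegsFromFemtoAndGapStubLowerThreePointMain
import Summits.QuantumFields.YangMills.Theorems.BalabanLadderUVSeamRecUnitDilation
import HarnessLib

/-!
# Crux `UVSeamRec` (stmt-QuantumFields-20043), floors side: parametric three-point floor from the WEAK clauses (A), (T)

Helper file of the fleet lead prover of crux `NT` (unit `ym-spine-19353-p1`, g2), for the seam's femto discharge path.
VERBATIM re-run of the landed `WindowFloors.threePoint_floor_param_ratio`
(`Theorems/BalabanLadderUVSeamRecWindowFloorsThreePointParamRatio.lean`, ym-spine-20043-p1) with `FC2 G r a` replaced by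
the SIGN-FREE clustering clause (A) and `FC3 G r a` by the weak third-cumulant clause (T) of crux `NT`'s skeleton v3
«weak-package» (374f16092bb0c203) — through the landed `WeakPackage.triple_floor_weak`
(`Theorems/BalabanLadderNTWeakPackageThreePoint.lean`).  (A) itself follows from `FBL` (`BoundaryLaw.abs_of_fbl`).

* `threePoint_floor_param_ratio_weak` — parametric three-point floor, window `[κs, s]`, from `FBL ∧ (A) ∧ (T)`.
-/

set_option autoImplicit false

noncomputable section

open scoped SchwartzMap
open MeasureTheory Filter Topology Metric
open Literature.MathematicalPhysics.QuantumFieldTheory Literature.MathematicalPhysics.QuantumLattice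
open Literature.MathematicalPhysics.AQFT Literature.Probability.LatticeModels
open Summit.QuantumFields.YangMills.Theorems.OSLegsFromFemtoAndGap.StubLower
open Summit.QuantumFields.YangMills.Cruxes.OSLegsFromFemtoAndGap.DlrCollarTransfer
open Summit.QuantumFields.YangMills.Cruxes.OSLegsFromFemtoAndGap.DlrCollarTransfer.StubLower

namespace Summit.QuantumFields.YangMills.Cruxes.UVSeamRec.WeakWindow

section ThreePoint

variable (G : Type) [Group G] [TopologicalSpace G] [IsTopologicalGroup G] [CompactSpace G]
  [MeasurableSpace G] [BorelSpace G] (r : LatticeRep G) (a : ℝ → ℝ)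

/-- **Parametric three-point floor, ratio `κ`, weak clauses.**  From `FBL ∧ (A) ∧ (T)` at a unit map `a > 0`, `a → 0`: there are the
reference shape `(v, w, δ)` of (T), a master scale `s > 0` and `ε, β₅, Λ₅` such that for EVERY scale `s' ∈ [κs, s]` and EVERY three test
functions `f, g, h ≥ 0` equal to `1` on the plateau balls of radius `δ s'/8` around `0`, `s' • v`, `s' • w` and vanishing off
the doubled balls, the connected three-point function is floored: `ε ≤ |Q3 G r β L (a β) (f, g, h)|` for `β ≥ β₅`,
`Λ₅ ≤ a β · L` (= `StubLower.lowerBounds_threePoint` with the bumps as parameters; every estimate is the landed toolkit's). [folklore] -/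
theorem threePoint_floor_param_ratio_weak {κ : ℝ} (hκ : 0 < κ) (hapos : ∀ β, 0 < a β) (hlim : Tendsto a atTop (𝓝 0))
    (hFBL : FBL G r a)
    (hA : ∃ (β₂ ℓ₂ C₂ : ℝ) (K : ℝ → ℝ) (n₀ : ℕ), 0 < ℓ₂ ∧ (∀ s, 1 ≤ K s) ∧
      Tendsto (fun s : ℝ => s * K s) (nhdsWithin 0 (Set.Ioi 0)) (nhds 0) ∧ 1 ≤ n₀ ∧
      ∀ β : ℝ, β₂ ≤ β → ∀ (x : Fin 4 → ℤ) (R : ℕ), ((2 * R + 1 : ℕ) : ℝ) * a β ≤ ℓ₂ →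
        ∀ (η : LGConfig 4 G) (u u' : Fin 4 → ℤ) (s₀ : ℝ), 0 < s₀ → s₀ ≤ ‖siteToE (u' - u)‖ * a β →
          ‖siteToE (u' - u)‖ * a β ≤ ℓ₂ → (n₀ : ℝ) ≤ ‖siteToE (u' - u)‖ →
            K s₀ * ‖siteToE (u' - u)‖ ≤ depth (fun j => x j - R) (2 * R + 1) u →
            K s₀ * ‖siteToE (u' - u)‖ ≤ depth (fun j => x j - R) (2 * R + 1) u' →
              |‖siteToE (u' - u)‖ ^ 8 *
                  kerCov G r β (fun j => x j - R) (2 * R + 1) η (dens G r u) (dens G r u')| ≤ C₂)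
    (hT : ∃ (v w : EuclideanSpace ℝ (Fin 4)) (σ δ : ℝ) (Γ₃ : ℝ → ℝ) (β₃ ℓ₃ c₃ : ℝ) (K₃ : ℝ → ℝ) (n₃ : ℕ),
      (σ = 1 ∨ σ = -1) ∧ 0 < δ ∧ 2 * δ < ‖v‖ ∧ 2 * δ < ‖w‖ ∧ 2 * δ < ‖v - w‖ ∧ 0 < ℓ₃ ∧ 0 < c₃ ∧
      (∀ s, 1 ≤ K₃ s) ∧ Tendsto (fun s : ℝ => s * K₃ s) (nhdsWithin 0 (Set.Ioi 0)) (nhds 0) ∧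
      Tendsto (fun s : ℝ => Γ₃ s / s ^ 4) (nhdsWithin 0 (Set.Ioi 0)) atTop ∧
      ∀ β : ℝ, β₃ ≤ β → ∀ (x : Fin 4 → ℤ) (R : ℕ), ((2 * R + 1 : ℕ) : ℝ) * a β ≤ ℓ₃ →
        ∀ (η : LGConfig 4 G) (n : ℕ) (y z : Fin 4 → ℤ) (s₀ : ℝ), 0 < s₀ → s₀ ≤ (n : ℝ) * a β →
          n₃ ≤ n → ‖siteToE (y - x) - (n : ℝ) • v‖ ≤ δ * n → ‖siteToE (z - x) - (n : ℝ) • w‖ ≤ δ * n →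
            K₃ s₀ * n ≤ depth (fun j => x j - R) (2 * R + 1) x →
            K₃ s₀ * n ≤ depth (fun j => x j - R) (2 * R + 1) y →
            K₃ s₀ * n ≤ depth (fun j => x j - R) (2 * R + 1) z →
              c₃ * Γ₃ ((n : ℝ) * a β) ≤
                σ * (n : ℝ) ^ 12 * kerK3 G r β (fun j => x j - R) (2 * R + 1) η x y z) :
    ∃ (v w : EuclideanSpace ℝ (Fin 4)) (δ s ε β₅ Λ₅ : ℝ), 0 < δ ∧ 2 * δ < ‖v‖ ∧ 2 * δ < ‖w‖ ∧ 2 * δ < ‖v - w‖ ∧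
      0 < s ∧ 0 < ε ∧ ∀ s' ∈ Set.Icc (κ * s) s, ∀ f g h : 𝓢(EuclideanSpace ℝ (Fin 4), ℝ),
        (∀ z, 0 ≤ f z) → (∀ z, dist z (0 : EuclideanSpace ℝ (Fin 4)) ≤ δ * s' / 8 → f z = 1) →
        (∀ z, f z ≠ 0 → dist z (0 : EuclideanSpace ℝ (Fin 4)) < 2 * (δ * s' / 8)) →
        (∀ z, 0 ≤ g z) → (∀ z, dist z (s' • v) ≤ δ * s' / 8 → g z = 1) → (∀ z, g z ≠ 0 → dist z (s' • v) < 2 * (δ * s' / 8)) →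
        (∀ z, 0 ≤ h z) → (∀ z, dist z (s' • w) ≤ δ * s' / 8 → h z = 1) → (∀ z, h z ≠ 0 → dist z (s' • w) < 2 * (δ * s' / 8)) →
        ∀ β : ℝ, β₅ ≤ β → ∀ L : ℕ, Λ₅ ≤ a β * L → ε ≤ |Q3 G r β L (a β) f g h| := by
  obtain ⟨C₁, β₁, ℓ₁, p, hℓ₁, hC₁, hFBLc⟩ := hFBL
  obtain ⟨β₂, ℓ₂, C₂, K, n₀, hℓ₂, hK1, hKlim, hn₀, hAbsc⟩ := hA
  obtain ⟨v, w, σ, δ, Γ₃, β₃, ℓ₃, c₃, K₃, n₃, hσ, hδ, h2v, h2w, h2vw, hℓ₃, hc₃, hK₃1, hK₃lim, hΓ₃lim, hFC3c⟩ :=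
    hT
  -- the constants
  obtain ⟨ℓ, hℓ⟩ : ∃ ℓ : ℝ, ℓ = min (min ℓ₁ ℓ₂) ℓ₃ := ⟨_, rfl⟩
  have hℓ0 : 0 < ℓ := by rw [hℓ]; exact lt_min (lt_min hℓ₁ hℓ₂) hℓ₃
  have hℓℓ₁ : ℓ ≤ ℓ₁ := hℓ ▸ (min_le_left _ _).trans (min_le_left _ _)
  have hℓℓ₂ : ℓ ≤ ℓ₂ := hℓ ▸ (min_le_left _ _).trans (min_le_right _ _)
  have hℓℓ₃ : ℓ ≤ ℓ₃ := hℓ ▸ min_le_right _ _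
  obtain ⟨Vmin, Vmax, hVmin, hVmax, hVV, hVv, hVw, hVvw, hVv', hVw', hVvw', hδV⟩ :=
    shape_constants hδ h2v h2w h2vw
  obtain ⟨D, hD⟩ : ∃ D : ℝ, D = ℓ / 100 := ⟨_, rfl⟩
  have hD0 : 0 < D := by rw [hD]; positivity
  obtain ⟨smax, hsmax⟩ : ∃ smax : ℝ, smax = ℓ / (100 * (Vmax + 1)) := ⟨_, rfl⟩
  have hsmax0 : 0 < smax := by rw [hsmax]; positivity
  have hC₂p : 0 ≤ max C₂ 0 := le_max_right _ _
  obtain ⟨M₃, hM₃⟩ : ∃ M₃ : ℝ, M₃ = 12 * C₁ * max C₂ 0 / (c₃ * D ^ 4 * Vmin ^ 8)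
    + 16 * C₁ ^ 3 * smax ^ 8 / (c₃ * D ^ 12) + 1 := ⟨_, rfl⟩
  have hM₃0 : 0 < M₃ := by rw [hM₃]; positivity
  obtain ⟨δ₁, hδ₁, hKδ⟩ := exists_delta_of_tendsto_mul hKlim (ε := ℓ * Vmin / (10 * Vmax)) (by positivity)
  obtain ⟨δ₂, hδ₂, hK₃δ⟩ := exists_delta_of_tendsto_mul hK₃lim (ε := ℓ / 20) (by positivity)
  obtain ⟨δ₃, hδ₃, hΓ₃δ⟩ := exists_delta_of_tendsto_div_atTop hΓ₃lim M₃
  obtain ⟨S, hS⟩ : ∃ S : ℝ, S = min (min (δ₁ / (2 * (Vmin + 1))) δ₂) (min (δ₃ / 2) smax) := ⟨_, rfl⟩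
  have hS0 : 0 < S := by rw [hS]; positivity
  have hS₁ : S ≤ δ₁ / (2 * (Vmin + 1)) := hS ▸ (min_le_left _ _).trans (min_le_left _ _)
  have hS₂ : S ≤ δ₂ := hS ▸ (min_le_left _ _).trans (min_le_right _ _)
  have hS₃ : S ≤ δ₃ / 2 := hS ▸ (min_le_right _ _).trans (min_le_left _ _)
  have hS₄ : S ≤ smax := hS ▸ (min_le_right _ _).trans (min_le_right _ _)
  -- small spacings, uniformly for `s ≥ κ S`
  have hκS : 0 < κ * S := mul_pos hκ hS0
  have hn₀0 : (0 : ℝ) < n₀ := by exact_mod_cast hn₀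
  obtain ⟨β₀, hβ₀⟩ := exists_of_tendsto_atTop_nhds_zero hlim
    (a₀ := min (min (min (ℓ / 100) (δ * (κ * S) / 16)) (min (κ * S / 2) (κ * S / ((n₃ : ℝ) + 1))))
      (min (min (δ * (κ * S) / (2 * (‖v‖ + δ))) (δ * (κ * S) / (2 * (‖w‖ + δ)))) (κ * S * Vmin / n₀)))
    (by positivity)
  -- the floor constant is monotone in the scale
  have hεmono : ∀ x y : ℝ, 0 < x → x ≤ y →
      c₃ * M₃ / (2 * x ^ 8) * (δ * x / 16) ^ 12 ≤ c₃ * M₃ / (2 * y ^ 8) * (δ * y / 16) ^ 12 := by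
    intro x y hx hxy
    have e : ∀ z : ℝ, 0 < z → c₃ * M₃ / (2 * z ^ 8) * (δ * z / 16) ^ 12 = c₃ * M₃ * δ ^ 12 / (2 * 16 ^ 12) * z ^ 4 := by
      intro z hz
      have hz' : z ≠ 0 := hz.ne'
      field_simp
    rw [e x hx, e y (hx.trans_le hxy)]
    exact mul_le_mul_of_nonneg_left (pow_le_pow_left₀ hx.le hxy 4) (by positivity)
  refine ⟨v, w, δ, S, c₃ * M₃ / (2 * (κ * S) ^ 8) * (δ * (κ * S) / 16) ^ 12, max (max β₀ β₁) (max β₂ β₃), ℓ,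
    hδ, h2v, h2w, h2vw, hS0, by positivity, ?_⟩
  intro s hsw f g h hf0 hfone hfsupp hg0 hgone hgsupp hh0 hhone hhsupp β hβ L hL
  obtain ⟨hslo, hshi⟩ := hsw
  have hs0 : 0 < s := by linarith only [hslo, hκS]
  have hs₁ : s ≤ δ₁ / (2 * (Vmin + 1)) := hshi.trans hS₁
  have hs₂ : s ≤ δ₂ := hshi.trans hS₂
  have hs₃ : s ≤ δ₃ / 2 := hshi.trans hS₃
  have hs₄ : s ≤ smax := hshi.trans hS₄
  have hsδ₃ : s < δ₃ := by linarith only [hs₃, hδ₃]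
  have hsV : s * Vmax ≤ ℓ / 100 := by
    have h1 : s * Vmax ≤ smax * Vmax := mul_le_mul_of_nonneg_right hs₄ hVmax.le
    have h2 : smax * Vmax ≤ ℓ / 100 := by
      rw [hsmax, div_mul_eq_mul_div, div_le_div_iff₀ (by positivity) (by positivity)]
      have : 0 ≤ ℓ * 100 := by positivity
      linarith only [this]
    linarith only [h1, h2]
  have hsℓ : s ≤ ℓ / 100 := by
    have : smax ≤ ℓ / 100 :=
      hsmax ▸ div_le_div_of_nonneg_left hℓ0.le (by positivity) (by linarith only [hVmax])
    linarith only [this, hs₄]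
  -- growth clauses at the scale `s`
  have hsVmin : s * Vmin < δ₁ := by
    have h1 : s * Vmin ≤ δ₁ / (2 * (Vmin + 1)) * Vmin := mul_le_mul_of_nonneg_right hs₁ hVmin.le
    have h2 : δ₁ / (2 * (Vmin + 1)) * Vmin < δ₁ := by
      rw [div_mul_eq_mul_div, div_lt_iff₀ (by positivity)]
      exact mul_lt_mul_of_pos_left (by linarith only [hVmin]) hδ₁
    linarith only [h1, h2]
  have hs0' : s ≠ 0 := hs0.ne'
  have hVmin0 : Vmin ≠ 0 := hVmin.ne'
  have hVmax0 : Vmax ≠ 0 := hVmax.ne'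
  have hKt : s * Vmax * K (s * Vmin) < ℓ / 10 := by
    have h1 := hKδ (s * Vmin) (by positivity) hsVmin
    have e : s * Vmax * K (s * Vmin) = s * Vmin * K (s * Vmin) * (Vmax / Vmin) := by
      field_simp
    rw [e]
    calc s * Vmin * K (s * Vmin) * (Vmax / Vmin) < ℓ * Vmin / (10 * Vmax) * (Vmax / Vmin) :=
          mul_lt_mul_of_pos_right h1 (by positivity)
      _ = ℓ / 10 := by field_simp
  have hK₃t : s * K₃ (s / 2) < ℓ / 10 := by
    have := hK₃δ (s / 2) (by positivity) (by linarith only [hs₂, hs0])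
    linarith only [this]
  have hM₃C := M3_bound (C₂p := max C₂ 0) hC₁ hc₃ hD0 hVmin hs0 hs₄
  rw [← hM₃] at hM₃C
  have hββ₀ : β₀ ≤ β := le_of_max_le_left (le_of_max_le_left hβ)
  have hββ₁ : β₁ ≤ β := le_of_max_le_right (le_of_max_le_left hβ)
  have hββ₂ : β₂ ≤ β := le_of_max_le_left (le_of_max_le_right hβ)
  have hββ₃ : β₃ ≤ β := le_of_max_le_right (le_of_max_le_right hβ)
  have hα := hapos β
  have hαa₀ := (hβ₀ β hββ₀).le
  have hαℓ : a β ≤ ℓ / 100 :=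
    hαa₀.trans ((min_le_left _ _).trans ((min_le_left _ _).trans (min_le_left _ _)))
  have hα16' : a β ≤ δ * (κ * S) / 16 :=
    hαa₀.trans ((min_le_left _ _).trans ((min_le_left _ _).trans (min_le_right _ _)))
  have hα2' : a β ≤ κ * S / 2 :=
    hαa₀.trans ((min_le_left _ _).trans ((min_le_right _ _).trans (min_le_left _ _)))
  have hαn₃'' : a β ≤ κ * S / ((n₃ : ℝ) + 1) :=
    hαa₀.trans ((min_le_left _ _).trans ((min_le_right _ _).trans (min_le_right _ _)))
  have hαv'' : a β ≤ δ * (κ * S) / (2 * (‖v‖ + δ)) :=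
    hαa₀.trans ((min_le_right _ _).trans ((min_le_left _ _).trans (min_le_left _ _)))
  have hαw'' : a β ≤ δ * (κ * S) / (2 * (‖w‖ + δ)) :=
    hαa₀.trans ((min_le_right _ _).trans ((min_le_left _ _).trans (min_le_right _ _)))
  have hαn₀'' : a β ≤ κ * S * Vmin / n₀ := hαa₀.trans ((min_le_right _ _).trans (min_le_right _ _))
  have hδκ : δ * (κ * S) ≤ δ * s := mul_le_mul_of_nonneg_left hslo hδ.le
  have hα16 : a β ≤ δ * s / 16 := by
    have : δ * (κ * S) / 16 ≤ δ * s / 16 := by linarith only [hδκ]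
    exact hα16'.trans this
  have hα2 : a β ≤ s / 2 := by linarith only [hα2', hslo]
  have hnv0 : 0 < ‖v‖ + δ := by positivity
  have hnw0 : 0 < ‖w‖ + δ := by positivity
  have hn₃0 : (0 : ℝ) < (n₃ : ℝ) + 1 := by positivity
  have hαn₃' : a β ≤ s / ((n₃ : ℝ) + 1) :=
    hαn₃''.trans (div_le_div_of_nonneg_right hslo hn₃0.le)
  have hαv' : a β ≤ δ * s / (2 * (‖v‖ + δ)) :=
    hαv''.trans (div_le_div_of_nonneg_right hδκ (by positivity))
  have hαw' : a β ≤ δ * s / (2 * (‖w‖ + δ)) :=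
    hαw''.trans (div_le_div_of_nonneg_right hδκ (by positivity))
  have hαn₀' : a β ≤ s * Vmin / n₀ :=
    hαn₀''.trans (div_le_div_of_nonneg_right (mul_le_mul_of_nonneg_right hslo hVmin.le) hn₀0.le)
  have hαn₃ : ((n₃ : ℝ) + 1) * a β ≤ s := by
    rw [le_div_iff₀ (by positivity)] at hαn₃'; linarith only [hαn₃']
  have hαv : a β * (‖v‖ + δ) ≤ δ * s / 2 := by
    rw [le_div_iff₀ (by positivity)] at hαv'; linarith only [hαv']
  have hαw : a β * (‖w‖ + δ) ≤ δ * s / 2 := by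
    rw [le_div_iff₀ (by positivity)] at hαw'; linarith only [hαw']
  have hαn₀ : (n₀ : ℝ) * a β ≤ s * Vmin := by
    rw [le_div_iff₀ hn₀0] at hαn₀'; linarith only [hαn₀']
  obtain ⟨hfem₁, hfem₂, hfem₃, hL', hsℓ₂⟩ := femto_budget3 (k := K (s * Vmin)) (k₃ := K₃ (s / 2))
    (L := L) hℓ0.le hℓℓ₁ hℓℓ₂ hℓℓ₃ hKt hK₃t hsV hαℓ hL
  rw [← hD] at hfem₁ hfem₂ hfem₃ hL'
  -- the per-triple floor
  have key : ∀ x y z : Fin 4 → ℤ, f (a β • siteToE x) ≠ 0 → g (a β • siteToE y) ≠ 0 →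
      h (a β • siteToE z) ≠ 0 → c₃ * M₃ / (2 * s ^ 8) * a β ^ 12 ≤ σ * torusK3 G r β L x y z := by
    intro x y z hx hy hz
    refine NT.WeakPackage.triple_floor_weak G r a hC₁ hFBLc hK1 hAbsc hσ hδ hc₃ hK₃1 hFC3c hs0 hD0 hM₃0.le hVmin
      hVv hVw hVvw hVv' hVw' hVvw' hΓ₃δ hsδ₃ hsℓ₂ hM₃C hββ₁ hββ₂ hββ₃ hα hαn₀ hαn₃ hα2 hαv hαw
      hfem₁ hfem₂ hfem₃ hL' x y z ?_ ?_ ?_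
    · have := hfsupp _ hx
      rw [dist_eq_norm, sub_zero] at this
      linarith only [this]
    · have := hgsupp _ hy
      rw [dist_eq_norm] at this
      linarith only [this]
    · have := hhsupp _ hz
      rw [dist_eq_norm] at this
      linarith only [this]
  -- Riemann mass of the three plateaux
  have hcov2 : 2 * (s * Vmax) ≤ a β * L := by linarith only [hsV, hL, hℓ0]
  have hnv : ‖s • v‖ ≤ s * Vmax := by
    rw [norm_smul, Real.norm_eq_abs, abs_of_pos hs0]
    exact mul_le_mul_of_nonneg_left (by linarith only [hVv', hδ]) hs0.le
  have hnw : ‖s • w‖ ≤ s * Vmax := by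
    rw [norm_smul, Real.norm_eq_abs, abs_of_pos hs0]
    exact mul_le_mul_of_nonneg_left (by linarith only [hVw', hδ]) hs0.le
  have hn0 : ‖(0 : EuclideanSpace ℝ (Fin 4))‖ ≤ s * Vmax := by rw [norm_zero]; positivity
  have h2α : 2 * a β ≤ δ * s / 8 := by linarith only [hα16]
  have hSf : (δ * s / 8 / (2 * a β)) ^ 4 ≤ ∑ x ∈ box 4 L, f (a β • siteToE x) :=
    pow_le_sum_box hf0 hα (fun z hz => hfone z hz) h2α (centre_cover hs0.le hn0 hδV hcov2)
  have hSg : (δ * s / 8 / (2 * a β)) ^ 4 ≤ ∑ y ∈ box 4 L, g (a β • siteToE y) :=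
    pow_le_sum_box hg0 hα (fun z hz => hgone z hz) h2α (centre_cover hs0.le hnv hδV hcov2)
  have hSh : (δ * s / 8 / (2 * a β)) ^ 4 ≤ ∑ z ∈ box 4 L, h (a β • siteToE z) :=
    pow_le_sum_box hh0 hα (fun z hz => hhone z hz) h2α (centre_cover hs0.le hnw hδV hcov2)
  -- summation: `σ Q3 ≥ ε`
  have hsum := mul_sum_mul_sum_mul_sum_le (B := box 4 L) (κ := c₃ * M₃ / (2 * s ^ 8) * a β ^ 12)
    (f := fun x => f (a β • siteToE x)) (g := fun y => g (a β • siteToE y))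
    (h := fun z => h (a β • siteToE z)) (C := fun x y z => σ * torusK3 G r β L x y z)
    (fun x => hf0 _) (fun y => hg0 _) (fun z => hh0 _) key
  have hσQ : σ * Q3 G r β L (a β) f g h =
      ∑ x ∈ box 4 L, ∑ y ∈ box 4 L, ∑ z ∈ box 4 L,
        f (a β • siteToE x) * g (a β • siteToE y) * h (a β • siteToE z) *
          (σ * torusK3 G r β L x y z) := by
    unfold Q3
    rw [Finset.mul_sum]
    refine Finset.sum_congr rfl fun x _ => ?_
    rw [Finset.mul_sum]
    refine Finset.sum_congr rfl fun y _ => ?_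
    rw [Finset.mul_sum]
    refine Finset.sum_congr rfl fun z _ => ?_
    ring
  have hσabs : σ * Q3 G r β L (a β) f g h ≤ |Q3 G r β L (a β) f g h| := by
    rcases hσ with rfl | rfl
    · rw [one_mul]; exact le_abs_self _
    · rw [neg_one_mul]; exact neg_le_abs _
  refine (hεmono (κ * S) s hκS hslo).trans ?_
  refine le_trans ?_ hσabs
  rw [hσQ]
  refine le_trans ?_ hsum
  have hα0 : a β ≠ 0 := hα.ne'
  have hpos : (0 : ℝ) ≤ (δ * s / 8 / (2 * a β)) ^ 4 := by positivity
  calc c₃ * M₃ / (2 * s ^ 8) * (δ * s / 16) ^ 12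
      = c₃ * M₃ / (2 * s ^ 8) * a β ^ 12 *
          ((δ * s / 8 / (2 * a β)) ^ 4 * (δ * s / 8 / (2 * a β)) ^ 4 * (δ * s / 8 / (2 * a β)) ^ 4) := by
        field_simp; ring
    _ ≤ _ := mul_le_mul_of_nonneg_left (mul_le_mul (mul_le_mul hSf hSg hpos (hpos.trans hSf)) hSh
        hpos (mul_nonneg (hpos.trans hSf) (hpos.trans hSg))) (by positivity)

end ThreePoint

end Summit.QuantumFields.YangMills.Cruxes.UVSeamRec.WeakWindow

end
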